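/-
Copyright (c) 2026 the pub-hodgecm-mathlib formalisation cell (harness21).  Prover seat hodgecm-mathlib-LH4-p01 (g10): road M6 → F3 «TOT-Λ BY OVER-ORDERS» (LEAD F0P3a-plan
T14-66), carve (c5-ii) «MODEL PACKAGE SELECTION» (F3-5 pen LH7-p04 (g12) 00:24:06Z «= TAKE»), FILE A «THE INTEGRAL EISENSTEIN FRAME AT AN INERT PLACE»; 2026-09-03.
-/
import Literature.NumberTheory.Rogawski1990.TypeTwoUnitIndexAtPlace              -- ★ (D5) (F0P3a-p08): `exists_integer_ringHom_of_map_mem_integer` + the place dictionary (★ Σ2-CM `SplitTorusOrderFixedSidePlace`: `exists_integer_ringHom_toPlace`, `injective_of_coe_eq_toPlace`, `exists_map_eq_of_galAdicCompletionMap_eq`, `exists_isUnit_galAdicCompletionMap_sub`, `natCard_residueField_eq_natCard_residueField_sq`; ★ `exists_mul_galAdicCompletionMap_eq_of_inert`; ★ `valued_toPlace_of_isUnramifiedIn`; ★ `algEquiv_mul_self_eq_one`; ★ `map_k₀_mem_maximalIdeal`)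
import Literature.NumberTheory.LocalFields.UnramifiedNormLevelSurjective        -- ★ (r1) p852954 (LH10-p01 (g10)): `exists_sub_one_mem_span_pow_and_mul_map_eq` (= `hnormEb`, `b ≥ 1`)
import Literature.NumberTheory.Automorphic.LatticeIndexGL                        -- ★ `IsUniformizingElement.irreducible_coe`
import HarnessLib

/-!
# The integral Eisenstein frame at an inert place: the thirty frame letters of ★ F3-3 ∕ ★ F3-1a ∕ ★ F3-5b from an eigen-field package `(θ, s̃)` over `E_w ∕ F_v`
# (Serre, Corps locaux I §6, II §4–5, V §2; Neukirch II §4; Rogawski 1990 §4.9)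

Topic `NumberTheory/Rogawski1990`; namespace `Literature.NumberTheory.Rogawski1990`.  ONE THEOREM + one lemma (no definition, no instance, no notation, no named fact, no
`sorry`); kernel lane `--supports stmt-HodgeConjecture-24833`.  Cell `pub/hodgecm-mathlib` (D-0151), crux H413 = `stmt-HodgeConjecture-24833`; road M6 → F3 «TOT-Λ by
over-orders» (route (B)); carve **(c5-ii) «MODEL PACKAGE SELECTION», FILE A**: the instantiation, at an INERT-UNRAMIFIED place `w ∣ v` of a quadratic extension of number
fields `E ∕ F` (`c • w = w`), of the abstract «inert dictionary + Eisenstein letters» of ★ (L3′) `QuadraticEisensteinOrderNormIndex` ∕ ★ F3-3 (UG)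
`GluedOverOrderUnitaryGenerator` ∕ ★ F3-1a `GluedOverOrders` ∕ ★ (c6) `GluedOverOrderOfUnitaryPair` ∕ F3-5b-I `OverOrderStrataVerdicts` — the letters
`ιO σO jO σKO θ aF k₀F  hσσ hσι hfixO hιinj hιu htr hσ₁j hσ₁θ hθ haF hk₀ hcoord hnormE hnorm₁ hnormEb hϖF hϖ hιϖ hk₁ hq hξ hσv hσKv hOK` — from an EIGEN-FIELD PACKAGE
`(θ, s̃)` of ★ (D2-β)-shape over a GENERAL Eisenstein pair `(aF, k₀)` of `F_v` (`|aF|_v < 1`, `|k₀|_v = |ϖ_v|`): `K = M_{w₁}` for an auxiliary quadratic `M ⊃ E` with `w₁ ∣ w`,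
`θ ∈ K` with `θ² = ι₁ι(aF)·θ + ι₁ι(k₀)`, unique `E_w`-coordinates on `(1, θ)` with the integrality criterion, and an involution `s̃` of `K` over `σ_w` fixing `θ`, mapping `𝒪_K`
into itself, isometric, with the (nK) dictionary «`s̃`-fixed of even order ⇒ `s̃`-norm».  ROWS: `aF = 0`, `k₀ = d` a uniformiser — the TAME row and the WILD ODD row, package =
★ F4-a′ `TypeTwoEigenFieldPackageUniformiser.exists_eigenField_package_uniformiser` ∕ ★ (D2-β); `aF = −2∕ϖ^k`, `k₀ = w₀∕ϖ^{2k}`, `θ = (α − 1)∕ϖ^k` (`α² = 1 + w₀`) — the WILD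
UNIT row, package = ★ (D5)′ `TypeTwoUnitIndexAtPlaceWild`'s input letters ∕ ★ `WildQuadraticEisensteinFrame`.  This file is the row-FREE common part of ★ (D5) ∕ (D5)′ ∕ (D5)″
§0–§4 (there internal to the proofs), EXPORTED once, with the three additions F3-5b needs (`htr`, `hnormEb` for `b ≥ 1` = ★ (r1), the `valuation`-currency isometries).
HONEST LABEL: HC_CM is proved only modulo the 7 printed citations (2 remaining named inputs: hLiu418 = stmt-HodgeConjecture-24832, h413 = stmt-HodgeConjecture-24833) until rung 0
closes; unconditional local algebra at a place, count-neutral (pays no organ, opens no road; zero label movement until F5 ★ + a desk-priced rider).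

THE MATHEMATICS (Serre II §4–5, V §2).  `F_v ⊂ E_w` is the unramified quadratic extension of local fields at the inert place (`σ_w` its involution, `ι_w` the inclusion,
residue degree 2, so `#𝓀_w = q_v²`, a unit `ξ` with `ξ − σξ ∈ 𝒪^×` exists (the residual Frobenius is not the identity) and every `σ`-fixed unit, and every `σ`-fixed principal
unit of any level `b ≥ 1`, is a norm — ★ `exists_mul_galAdicCompletionMap_eq_of_inert`, ★ (r1)); the trace-one element is `b₀ := −ξ·(σξ − ξ)⁻¹` (★ `exists_add_map_eq_one_of_isUnit_sub'`).  `K = E_w(θ) = M_{w₁}` is totally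
ramified quadratic over `E_w` with Eisenstein generator `θ` (`𝒪_K = 𝒪_w ⊕ 𝒪_w θ` is the integrality criterion `hint`), `s̃` restricts to integer rings, and its (nK) clause
restricted to units is `hnorm₁`.  Everything is transported to the integer rings along the coercions `𝒪 → field` (★ (D5) `exists_integer_ringHom_of_map_mem_integer`).
NB the level-`b` norm clause is stated for `b ≥ 1` ONLY (at `b = 0` «every `σ`-fixed integer is a norm» is false: `ϖ` has odd order).
[cite: SerreLocalFields1979, Ch. I §6 Prop. 17–18; Ch. II §4–§5; Ch. V §2 Prop. 3 and Cor.] [cite: Neukirch1999, Ch. II §4 Prop. (4.3); Ch. I §12] [cite: Rogawski1990, §4.9 Lemma 4.9.3 p. 56]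

* §1 `toPlace_integer_mem_of_hint` (`hOK`); the trace-one element `htr` is ★ `UnramifiedQuadraticNorm.exists_add_map_eq_one_of_isUnit_sub'` (cited, not restated);
* §2 **`exists_integralEisensteinFrame_inertPlace`** — the package ⇒ the thirty letters (existential over the four integral ring maps, the integral lifts, `ξ`, `b₀` and the two
  `IsUniformizingElement` certificates of `k₀` and `ι_w k₀`).

## References
* [SerreLocalFields1979] J.-P. Serre, *Local Fields*, GTM 67 (1979): Ch. I §6 Prop. 17–18 (Eisenstein bases); Ch. II §4–§5 (unramified ∕ totally ramified extensions); Ch. V §2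
  Prop. 3 and Corollary (norms of units and of the unit filtration in the unramified case).
* [Neukirch1999] J. Neukirch, *Algebraic Number Theory*, Grundlehren 322 (1999): Ch. II §4 Prop. (4.3) (completions at a place); Ch. I §12 (orders).
* [Rogawski1990] J. D. Rogawski, *Automorphic Representations of Unitary Groups in Three Variables*, Ann. of Math. Stud. 123 (1990): §4.9 Lemma 4.9.3 p. 56, Prop. 4.9.1 (b) p. 55.
-/

set_option autoImplicit false

noncomputable section

open ValuativeRel NumberField IsDedekindDomain
open scoped ValuativeRel
open Literature.NumberTheory.Automorphic Literature.NumberTheory.Automorphic.UnitaryGroup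

namespace Literature.NumberTheory.Rogawski1990

/-! ## §1 One small letter: `hOK` -/

/-- **`hOK`**: under the integrality criterion `hint` on `(1, θ)`, `ι₁` maps `𝒪[E_w]` into `𝒪[K]` (take `q = 0`). [cite: Neukirch1999, Ch. II §4 Prop. (4.3)] -/
theorem toPlace_integer_mem_of_hint {E : Type} [Field E] [NumberField E] {w : HeightOneSpectrum (𝓞 E)}
    {M : Type} [Field M] [NumberField M] [Algebra E M] (w₁ : PlacesOver M w) {θ : w₁.1.adicCompletion M}
    (hint : ∀ p q : w.adicCompletion E, toPlace w w₁ p + toPlace w w₁ q * θ ∈ 𝒪[w₁.1.adicCompletion M] ↔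
      p ∈ 𝒪[w.adicCompletion E] ∧ q ∈ 𝒪[w.adicCompletion E])
    (r : 𝒪[w.adicCompletion E]) : toPlace w w₁ (r : w.adicCompletion E) ∈ 𝒪[w₁.1.adicCompletion M] := by
  have h := (hint r 0).2 ⟨r.2, zero_mem _⟩
  rwa [map_zero, zero_mul, add_zero] at h

/-! ## §2 The integral Eisenstein frame at an inert place -/

set_option maxHeartbeats 4000000 in
/-- **(c5-ii-A) THE INTEGRAL EISENSTEIN FRAME AT AN INERT PLACE.**  `E ∕ F` quadratic number fields, `c ≠ 1`, `v` unramified in `E`, `w ∣ v` with `c • w = w` (inert);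
an auxiliary quadratic `M ⊃ E` with `w₁ ∣ w` and an eigen-field package `(θ, s̃)` of ★ (D2-β)-shape over a GENERAL Eisenstein pair `(aF, k₀)` of `F_v` (`|aF| < 1`,
`|k₀| = exp(−1)`): `θ² = ι₁ι(aF)θ + ι₁ι(k₀)`, unique `E_w`-coordinates on `(1, θ)` with the integrality criterion, `s̃` over `σ_w` fixing `θ`, integral, isometric, with the (nK)
clause.  THEN there are integral ring maps `ιO, σO, jO, σKO` over `ι_w, σ_w, ι₁, s̃`, integral lifts `θO, aFO, k₀F` of `θ, aF, k₀`, a unit-different element `ξ`, a trace-one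
element `b₀`, and `IsUniformizingElement` certificates of `k₀` and `ι_w k₀`, satisfying ALL the frame letters of ★ (L3′) ∕ ★ (UG) ∕ ★ F3-1a ∕ ★ (c6) ∕ F3-5b-I:
`hσσ hσι hfixO hιinj hιu htr hσ₁j hσ₁θ hθ haF hk₀ hcoord hnormE hnorm₁ hnormEb (b ≥ 1) hιϖ hk₁ hq hξ hσv hσKv hOK` (see the module docstring for the row dictionary).
[cite: SerreLocalFields1979, Ch. II §4–§5; Ch. V §2 Prop. 3 and Cor.] [cite: Neukirch1999, Ch. II §4 Prop. (4.3)] [cite: Rogawski1990, §4.9 Lemma 4.9.3 p. 56] -/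
theorem exists_integralEisensteinFrame_inertPlace
    {F E : Type} [Field F] [NumberField F] [Field E] [NumberField E] [Algebra F E] [Algebra.IsQuadraticExtension F E]
    (c : E ≃ₐ[F] E) (v : HeightOneSpectrum (𝓞 F)) (hc : c ≠ 1) (hunr : Algebra.IsUnramifiedIn (𝓞 E) v.asIdeal)
    (w : PlacesOver E v) (hw : c • w.1 = w.1)
    -- the ramified eigen-field `K = M_{w₁}` and its (D2-β)-shape package over the Eisenstein pair `(aF, k₀)` of `F_v`
    {M : Type} [Field M] [NumberField M] [Algebra E M] (w₁ : PlacesOver M w.1)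
    {aF k₀ : v.adicCompletion F} (haF : Valued.v aF < 1) (hk₀ : Valued.v k₀ = WithZero.exp (-1 : ℤ))
    {θ : w₁.1.adicCompletion M} (s' : w₁.1.adicCompletion M →+* w₁.1.adicCompletion M)
    (hθ : θ ^ 2 = toPlace w.1 w₁ (toPlace v w aF) * θ + toPlace w.1 w₁ (toPlace v w k₀))
    (hcoord : ∀ z : w₁.1.adicCompletion M, ∃! pq : w.1.adicCompletion E × w.1.adicCompletion E, z = toPlace w.1 w₁ pq.1 + toPlace w.1 w₁ pq.2 * θ)
    (hint : ∀ p q : w.1.adicCompletion E, toPlace w.1 w₁ p + toPlace w.1 w₁ q * θ ∈ 𝒪[w₁.1.adicCompletion M] ↔ p ∈ 𝒪[w.1.adicCompletion E] ∧ q ∈ 𝒪[w.1.adicCompletion E])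
    (hs'ι : ∀ x, s' (toPlace w.1 w₁ x) = toPlace w.1 w₁ (galAdicCompletionMap (L := E) c hw x)) (hs'θ : s' θ = θ)
    (hs'O : ∀ z : 𝒪[w₁.1.adicCompletion M], s' z ∈ 𝒪[w₁.1.adicCompletion M]) (hs'v : ∀ z, Valued.v (s' z) = Valued.v z)
    (hnorm1 : ∀ c₁ : w₁.1.adicCompletion M, c₁ ≠ 0 → s' c₁ = c₁ → Even (WithZero.log (Valued.v c₁)) → ∃ a : w₁.1.adicCompletion M, a * s' a * c₁ = 1) :
    ∃ (ιO : 𝒪[v.adicCompletion F] →+* 𝒪[w.1.adicCompletion E]) (σO : 𝒪[w.1.adicCompletion E] →+* 𝒪[w.1.adicCompletion E])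
      (jO : 𝒪[w.1.adicCompletion E] →+* 𝒪[w₁.1.adicCompletion M]) (σKO : 𝒪[w₁.1.adicCompletion M] →+* 𝒪[w₁.1.adicCompletion M])
      (thetaO : 𝒪[w₁.1.adicCompletion M]) (aFO k₀F : 𝒪[v.adicCompletion F]) (ξ b₀ : 𝒪[w.1.adicCompletion E])
      (hϖF : IsUniformizingElement k₀) (hϖE : IsUniformizingElement (toPlace v w k₀)),
      -- (0) the coercion specifications
      (∀ x : 𝒪[v.adicCompletion F], ((ιO x : 𝒪[w.1.adicCompletion E]) : w.1.adicCompletion E) = toPlace v w x) ∧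
      (∀ x : 𝒪[w.1.adicCompletion E], ((σO x : 𝒪[w.1.adicCompletion E]) : w.1.adicCompletion E) = galAdicCompletionMap (L := E) c hw x) ∧
      (∀ x : 𝒪[w.1.adicCompletion E], ((jO x : 𝒪[w₁.1.adicCompletion M]) : w₁.1.adicCompletion M) = toPlace w.1 w₁ x) ∧
      (∀ z : 𝒪[w₁.1.adicCompletion M], ((σKO z : 𝒪[w₁.1.adicCompletion M]) : w₁.1.adicCompletion M) = s' z) ∧
      (thetaO : w₁.1.adicCompletion M) = θ ∧ (aFO : v.adicCompletion F) = aF ∧ (k₀F : v.adicCompletion F) = k₀ ∧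
      -- (1) the inert dictionary `hσσ hσι hfixO hιinj hιu htr`
      (∀ x, σO (σO x) = x) ∧ (∀ y, σO (ιO y) = ιO y) ∧ (∀ x, σO x = x → ∃ y, ιO y = x) ∧ Function.Injective ιO ∧
      (∀ y, IsUnit (ιO y) → IsUnit y) ∧ b₀ + σO b₀ = 1 ∧
      -- (2) the Eisenstein letters `hσ₁j hσ₁θ hθ haF hk₀ hcoord`
      (∀ x, σKO (jO x) = jO (σO x)) ∧ σKO thetaO = thetaO ∧ thetaO ^ 2 = jO (ιO aFO) * thetaO + jO (ιO k₀F) ∧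
      aFO ∈ IsLocalRing.maximalIdeal 𝒪[v.adicCompletion F] ∧ k₀F ∈ IsLocalRing.maximalIdeal 𝒪[v.adicCompletion F] ∧
      (∀ z : 𝒪[w₁.1.adicCompletion M], ∃! bc : 𝒪[w.1.adicCompletion E] × 𝒪[w.1.adicCompletion E], z = jO bc.1 + jO bc.2 * thetaO) ∧
      -- (3) the norm dictionaries `hnormE hnorm₁` and `hnormEb` (`b ≥ 1`)
      (∀ b : 𝒪[w.1.adicCompletion E], IsUnit b → σO b = b → ∃ c' : 𝒪[w.1.adicCompletion E], c' * σO c' = b) ∧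
      (∀ z : 𝒪[w₁.1.adicCompletion M], IsUnit z → σKO z = z → ∃ w' : 𝒪[w₁.1.adicCompletion M], w' * σKO w' = z) ∧
      (∀ b : ℕ, 1 ≤ b → ∀ r : 𝒪[w.1.adicCompletion E], σO r = r →
        r - 1 ∈ Ideal.span ({(⟨toPlace v w k₀, hϖE.mem⟩ : 𝒪[w.1.adicCompletion E]) ^ b} : Set 𝒪[w.1.adicCompletion E]) →
        ∃ s : 𝒪[w.1.adicCompletion E], s - 1 ∈ Ideal.span ({(⟨toPlace v w k₀, hϖE.mem⟩ : 𝒪[w.1.adicCompletion E]) ^ b} : Set 𝒪[w.1.adicCompletion E]) ∧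
          s * σO s = r) ∧
      -- (4) uniformisers, residue fields, the unit different: `hιϖ hk₁ hq hξ`
      ιO ⟨k₀, hϖF.mem⟩ = ⟨toPlace v w k₀, hϖE.mem⟩ ∧
      valuation (w.1.adicCompletion E) ((ιO k₀F : 𝒪[w.1.adicCompletion E]) : w.1.adicCompletion E) = valuation (w.1.adicCompletion E) (toPlace v w k₀) ∧
      Nat.card 𝓀[w.1.adicCompletion E] = Nat.card 𝓀[v.adicCompletion F] ^ 2 ∧ IsUnit (ξ - σO ξ) ∧
      -- (5) isometries in `valuation`-currency and the integral reading `hσv hσKv hOK`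
      (∀ x : w.1.adicCompletion E, valuation (w.1.adicCompletion E) (galAdicCompletionMap (L := E) c hw x) = valuation (w.1.adicCompletion E) x) ∧
      (∀ z : w₁.1.adicCompletion M, valuation (w₁.1.adicCompletion M) (s' z) = valuation (w₁.1.adicCompletion M) z) ∧
      (∀ r : 𝒪[w.1.adicCompletion E], toPlace w.1 w₁ (r : w.1.adicCompletion E) ∈ 𝒪[w₁.1.adicCompletion M]) := by
  -- ### 0. Valuation bridges at the place (as ★ (D5)″ §0)
  have hσv : ∀ x : w.1.adicCompletion E, Valued.v (galAdicCompletionMap (L := E) c hw x) = Valued.v x :=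
    fun x => valued_galAdicCompletionMap (L := E) c hw x
  have hιv : ∀ y : v.adicCompletion F, Valued.v (toPlace v w y) = Valued.v y :=
    fun y => Literature.NumberTheory.Automorphic.Liu2021.LemD1IndexedNonVacuityInertCofinite.valued_toPlace_of_isUnramifiedIn E v hunr w y
  have hσσK : ∀ x : w.1.adicCompletion E, galAdicCompletionMap (L := E) c hw (galAdicCompletionMap (L := E) c hw x) = x :=
    galAdicCompletionMap_galAdicCompletionMap_of_smul_eq c w hc hw
  have hcc : c * c = 1 := algEquiv_mul_self_eq_one (F := F) hc
  have hsq : ∀ x : WithZero (Multiplicative ℤ), x * x = 1 → x = 1 := fun x h => by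
    rcases eq_or_ne x 0 with h0 | h0
    · rw [h0, zero_mul] at h; exact absurd h zero_ne_one
    · rw [← WithZero.exp_log h0, ← WithZero.exp_add, WithZero.exp_eq_one] at h
      rw [← WithZero.exp_log h0, show WithZero.log x = 0 by omega, WithZero.exp_zero]
  have hunitE : ∀ x : 𝒪[w.1.adicCompletion E], IsUnit x ↔ Valued.v (x : w.1.adicCompletion E) = 1 := fun x => by
    rw [(Valuation.integer.integers (valuation (w.1.adicCompletion E))).isUnit_iff_valuation_eq_one, v_eq_one_iff_valuation_eq_one]; rfl
  have hunitF : ∀ x : 𝒪[v.adicCompletion F], IsUnit x ↔ Valued.v (x : v.adicCompletion F) = 1 := fun x => by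
    rw [(Valuation.integer.integers (valuation (v.adicCompletion F))).isUnit_iff_valuation_eq_one, v_eq_one_iff_valuation_eq_one]; rfl
  have hunitK : ∀ x : 𝒪[w₁.1.adicCompletion M], IsUnit x ↔ Valued.v (x : w₁.1.adicCompletion M) = 1 := fun x => by
    rw [(Valuation.integer.integers (valuation (w₁.1.adicCompletion M))).isUnit_iff_valuation_eq_one, v_eq_one_iff_valuation_eq_one]; rfl
  have hmaxF : ∀ x : 𝒪[v.adicCompletion F], Valued.v (x : v.adicCompletion F) < 1 → x ∈ IsLocalRing.maximalIdeal 𝒪[v.adicCompletion F] :=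
    fun x hx => by rw [IsLocalRing.mem_maximalIdeal, mem_nonunits_iff, hunitF]; exact hx.ne
  -- ### 1. Integrality of the package data
  have hθO : θ ∈ 𝒪[w₁.1.adicCompletion M] := by
    have h := (hint 0 1).2 ⟨zero_mem _, one_mem _⟩
    rwa [map_zero, map_one, zero_add, one_mul] at h
  have hk₀O : k₀ ∈ 𝒪[v.adicCompletion F] := (v_le_one_iff_mem_integer k₀).1 (by
    rw [hk₀, ← WithZero.exp_zero]; exact WithZero.exp_le_exp.2 (by norm_num))
  have haFO : aF ∈ 𝒪[v.adicCompletion F] := (v_le_one_iff_mem_integer aF).1 haF.le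
  -- ### 2. The integral ring maps and the integral lifts (★ (D5) `exists_integer_ringHom_of_map_mem_integer`, ★ Σ2-CM)
  obtain ⟨ιO, hιO⟩ := exists_integer_ringHom_toPlace v w
  obtain ⟨jO, hjO⟩ := exists_integer_ringHom_toPlace w.1 w₁
  obtain ⟨σO, hσO⟩ := exists_integer_ringHom_of_map_mem_integer (galAdicCompletionMap (L := E) c hw) (mem_integer_galAdicCompletionMap c v w hw)
  obtain ⟨σKO, hσKO⟩ := exists_integer_ringHom_of_map_mem_integer s' hs'O
  obtain ⟨thetaO, hthetaO'⟩ : ∃ thetaO : 𝒪[w₁.1.adicCompletion M], (thetaO : w₁.1.adicCompletion M) = θ := ⟨⟨θ, hθO⟩, rfl⟩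
  obtain ⟨aFO, haF'⟩ : ∃ aFO : 𝒪[v.adicCompletion F], (aFO : v.adicCompletion F) = aF := ⟨⟨aF, haFO⟩, rfl⟩
  obtain ⟨k₀F, hk₀F'⟩ : ∃ k₀F : 𝒪[v.adicCompletion F], (k₀F : v.adicCompletion F) = k₀ := ⟨⟨_, hk₀O⟩, rfl⟩
  -- ### 3. The inert dictionary (★ (D5)″ §4 verbatim)
  have hσσ : ∀ x, σO (σO x) = x := fun x => Subtype.ext (by rw [hσO, hσO, hσσK])
  have hσι : ∀ y', σO (ιO y') = ιO y' := fun y' => Subtype.ext (by rw [hσO, hιO, galAdicCompletionMap_toPlace c w w hw])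
  have hfixO : ∀ x, σO x = x → ∃ y', ιO y' = x := fun x hx =>
    exists_map_eq_of_galAdicCompletionMap_eq v w c hc hw ιO hιO x (by rw [← hσO, hx])
  have hιinj : Function.Injective ιO := injective_of_coe_eq_toPlace v w ιO hιO
  have hιu : ∀ y', IsUnit (ιO y') → IsUnit y' := fun y' h => by
    rw [hunitF]; rw [hunitE, hιO, hιv] at h; exact h
  have hσ₁j : ∀ x, σKO (jO x) = jO (σO x) := fun x => Subtype.ext (by rw [hσKO, hjO, hjO, hσO, hs'ι])
  have hσ₁θ : σKO thetaO = thetaO := Subtype.ext (by rw [hσKO, hthetaO']; exact hs'θ)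
  have hθ' : thetaO ^ 2 = jO (ιO aFO) * thetaO + jO (ιO k₀F) :=
    Subtype.ext (by rw [Subring.coe_pow, Subring.coe_add, Subring.coe_mul, hjO, hjO, hιO, hιO, hthetaO', haF', hk₀F']; exact hθ)
  have haF'' : aFO ∈ IsLocalRing.maximalIdeal 𝒪[v.adicCompletion F] := hmaxF _ (by rw [haF']; exact haF)
  have hk₀' : k₀F ∈ IsLocalRing.maximalIdeal 𝒪[v.adicCompletion F] := hmaxF _ (by
    rw [hk₀F', hk₀, ← WithZero.exp_zero]; exact WithZero.exp_lt_exp.2 (by norm_num))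
  have hcoordO : ∀ z : 𝒪[w₁.1.adicCompletion M], ∃! bc : 𝒪[w.1.adicCompletion E] × 𝒪[w.1.adicCompletion E], z = jO bc.1 + jO bc.2 * thetaO := by
    intro z
    obtain ⟨⟨p, q⟩, hz, huniq⟩ := hcoord (z : w₁.1.adicCompletion M)
    have hpq : p ∈ 𝒪[w.1.adicCompletion E] ∧ q ∈ 𝒪[w.1.adicCompletion E] := (hint p q).1 (hz ▸ z.2)
    refine ⟨(⟨p, hpq.1⟩, ⟨q, hpq.2⟩), Subtype.ext ?_, fun bc hbc => ?_⟩
    · rw [Subring.coe_add, Subring.coe_mul, hjO, hjO, hthetaO']; exact hz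
    · have hbc' : (z : w₁.1.adicCompletion M) = toPlace w.1 w₁ bc.1 + toPlace w.1 w₁ bc.2 * θ := by
        have := congrArg (fun x : 𝒪[w₁.1.adicCompletion M] => (x : w₁.1.adicCompletion M)) hbc
        simp only [Subring.coe_add, Subring.coe_mul, hjO, hthetaO'] at this
        exact this
      have h := huniq (((bc.1 : w.1.adicCompletion E)), (bc.2 : w.1.adicCompletion E)) hbc'
      rw [Prod.mk.injEq] at h
      exact Prod.ext (Subtype.ext h.1) (Subtype.ext h.2)
  -- unit norms (nE), (nK): verbatim from ★ (D5)″
  have hnormE : ∀ a : 𝒪[w.1.adicCompletion E], IsUnit a → σO a = a → ∃ b, b * σO b = a := fun a ha hσa => by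
    obtain ⟨b, hb⟩ := LocalFields.UnramifiedQuadraticNorm.exists_mul_galAdicCompletionMap_eq_of_inert c v hc hcc hunr w hw a ha
      (by have := congrArg (fun x : 𝒪[w.1.adicCompletion E] => (x : w.1.adicCompletion E)) hσa; rwa [hσO] at this)
    exact ⟨b, Subtype.ext (by rw [Subring.coe_mul, hσO]; exact hb)⟩
  have hnorm₁ : ∀ z : 𝒪[w₁.1.adicCompletion M], IsUnit z → σKO z = z → ∃ w', w' * σKO w' = z := fun z hz hσz => by
    have hz1 : Valued.v (z : w₁.1.adicCompletion M) = 1 := (hunitK z).1 hz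
    have hz0 : (z : w₁.1.adicCompletion M) ≠ 0 := fun h0 => by rw [h0, map_zero] at hz1; exact zero_ne_one hz1
    have hσz' : s' (z : w₁.1.adicCompletion M) = z := by
      have := congrArg (fun x : 𝒪[w₁.1.adicCompletion M] => (x : w₁.1.adicCompletion M)) hσz; rwa [hσKO] at this
    obtain ⟨a, ha⟩ := hnorm1 z hz0 hσz' (by rw [hz1, WithZero.log_one]; exact ⟨0, rfl⟩)
    have hav' : Valued.v a = 1 := hsq _ (by
      have h := congrArg Valued.v ha
      rwa [map_mul, map_mul, hs'v, hz1, mul_one, map_one] at h)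
    have ha0 : a ≠ 0 := fun h0 => by rw [h0, map_zero] at hav'; exact zero_ne_one hav'
    have haO' : a⁻¹ ∈ 𝒪[w₁.1.adicCompletion M] := (v_le_one_iff_mem_integer _).1 (by rw [map_inv₀, hav', inv_one])
    refine ⟨⟨a⁻¹, haO'⟩, Subtype.ext ?_⟩
    rw [Subring.coe_mul, hσKO]
    change a⁻¹ * s' a⁻¹ = (z : w₁.1.adicCompletion M)
    rw [map_inv₀, ← mul_inv, ← mul_right_inj' (mul_ne_zero ha0 ((map_ne_zero s').2 ha0)), mul_inv_cancel₀ (mul_ne_zero ha0 ((map_ne_zero s').2 ha0)), ha]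
  -- ### 4. Uniformisers, residue fields, the unit different, the trace-one element
  have hϖF : IsUniformizingElement k₀ := isUniformizingElement_of_v_eq hk₀
  have hιk₀v : Valued.v (toPlace v w k₀) = WithZero.exp (-1 : ℤ) := by rw [hιv, hk₀]
  have hϖE : IsUniformizingElement (toPlace v w k₀) := isUniformizingElement_of_v_eq hιk₀v
  have hιϖ : ιO ⟨k₀, hϖF.mem⟩ = ⟨toPlace v w k₀, hϖE.mem⟩ := Subtype.ext (hιO _)
  have hk₁ : valuation (w.1.adicCompletion E) ((ιO k₀F : 𝒪[w.1.adicCompletion E]) : w.1.adicCompletion E) = valuation (w.1.adicCompletion E) (toPlace v w k₀) := by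
    rw [hιO, hk₀F']
  have hq : Nat.card 𝓀[w.1.adicCompletion E] = Nat.card 𝓀[v.adicCompletion F] ^ 2 := natCard_residueField_eq_natCard_residueField_sq c v hc hunr w hw
  obtain ⟨ξ, hξ0⟩ := exists_isUnit_galAdicCompletionMap_sub c v hc hunr w hw
  have hξ : IsUnit (ξ - σO ξ) := by
    have h := hξ0.neg
    rw [neg_sub] at h
    have hσOξ : σO ξ = ⟨galAdicCompletionMap (L := E) c hw ξ, mem_integer_galAdicCompletionMap c v w hw ξ⟩ := Subtype.ext (hσO ξ)
    rw [hσOξ]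
    exact h
  have hξ' : IsUnit (σO ξ - ξ) := by
    have hσOξ : σO ξ = ⟨galAdicCompletionMap (L := E) c hw ξ, mem_integer_galAdicCompletionMap c v w hw ξ⟩ := Subtype.ext (hσO ξ)
    rw [hσOξ]; exact hξ0
  obtain ⟨b₀, hb₀⟩ := LocalFields.UnramifiedQuadraticNorm.exists_add_map_eq_one_of_isUnit_sub' σO hσσ hξ'
  -- `hnormEb` for `b ≥ 1` (★ (r1))
  have hirr : Irreducible (⟨toPlace v w k₀, hϖE.mem⟩ : 𝒪[w.1.adicCompletion E]) := hϖE.irreducible_coe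
  have hnormEb : ∀ b : ℕ, 1 ≤ b → ∀ r : 𝒪[w.1.adicCompletion E], σO r = r →
      r - 1 ∈ Ideal.span ({(⟨toPlace v w k₀, hϖE.mem⟩ : 𝒪[w.1.adicCompletion E]) ^ b} : Set 𝒪[w.1.adicCompletion E]) →
      ∃ s : 𝒪[w.1.adicCompletion E], s - 1 ∈ Ideal.span ({(⟨toPlace v w k₀, hϖE.mem⟩ : 𝒪[w.1.adicCompletion E]) ^ b} : Set 𝒪[w.1.adicCompletion E]) ∧
        s * σO s = r := fun b hb =>
    LocalFields.UnramifiedQuadraticNorm.exists_sub_one_mem_span_pow_and_mul_map_eq c v hc hcc hunr w hw σO hσO hirr hb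
  -- valuation-currency isometries
  have hσv' : ∀ x : w.1.adicCompletion E, valuation (w.1.adicCompletion E) (galAdicCompletionMap (L := E) c hw x) = valuation (w.1.adicCompletion E) x :=
    fun x => (v_eq_iff_valuation_eq _ _).1 (hσv x)
  have hσKv' : ∀ z : w₁.1.adicCompletion M, valuation (w₁.1.adicCompletion M) (s' z) = valuation (w₁.1.adicCompletion M) z :=
    fun z => (v_eq_iff_valuation_eq _ _).1 (hs'v z)
  have hOK : ∀ r : 𝒪[w.1.adicCompletion E], toPlace w.1 w₁ (r : w.1.adicCompletion E) ∈ 𝒪[w₁.1.adicCompletion M] :=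
    fun r => toPlace_integer_mem_of_hint w₁ hint r
  -- ### 5. Assembly
  exact ⟨ιO, σO, jO, σKO, thetaO, aFO, k₀F, ξ, b₀, hϖF, hϖE, hιO, hσO, hjO, hσKO, hthetaO', haF', hk₀F', hσσ, hσι, hfixO, hιinj, hιu, hb₀, hσ₁j, hσ₁θ, hθ',
    haF'', hk₀', hcoordO, hnormE, hnorm₁, hnormEb, hιϖ, hk₁, hq, hξ, hσv', hσKv', hOK⟩

end Literature.NumberTheory.Rogawski1990

end
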